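import Summits.CriticalPhenomena.PercolationContinuityZ3.Theorems.Transplant.FKConnectivityAllQAdjacentHub
import Summits.CriticalPhenomena.PercolationContinuityZ3.Theorems.Transplant.FKConnectivityAllQArborealLimit
import HarnessLib

/-!
# Connectivity correlation inequalities — negative correlation of ADJACENT edges for `q < 1` already implies
# Ayyer–Linusson–Ravichandran's Conjecture 7.1 for the arboreal gas (composition of census g19's hub theorem with fk-1 g9's limit `q ↓ 0`)

Support file (`--supports stmt-CriticalPhenomena-4575`), census seat `prim-bschramm-census` (gen 19); builds on p205010 (kernel theorem,
internal audit signed; external expert review pending).  No definitions, no named facts, no sorries; standard axioms.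

`FK.hubFKPos_of_edgeNegCorrAdjFKLtOne` (this seat, `…AdjacentHub.lean`): the adjacent case of Grimmett's negative-correlation conjecture
(`EdgeNegCorrAdjFKLtOne`, equivalently fk-3's hub covariance bound `HubCovBoundFKLtOne`) gives the hub inequality `HubFKPos` for every `q > 0`;
fk-1 g9's `FK.arborealHubPos_of_hubFKPos` (`…ArborealLimit.lean`) transports `HubFKPos` along the arboreal curve `p_e(q) = w_e q/(1 − w_e + w_e q)`,
`q ↓ 0` (Grimmett Thm (1.23)) to the weighted-spanning-forest measure.  Hence `EdgeNegCorrAdjFKLtOne → ArborealHubPos` and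
`HubCovBoundFKLtOne → ArborealHubPos`: ALR's Conj. 7.1 `μ^F(u ↔ a)μ^F(v ↔ a) ≤ μ^F(u ↔ a ↔ v)` (arbitrary activities) follows from
adjacent-edge negative correlation of `φ_{p,q}`, `q < 1`, alone.  (The forest-intrinsic statement 'adjacent Kahn–Grimmett–Winkler ⇒ Conj 7.1'
— hypothesis only at `q = 0⁺` — is the census memo's paper reduction, HOME/FROM-census-g19-FOREST-COEF.md §4.)
[cite: AyyerLinussonRavichandran2025, §7 eq. (13), (15), (17), Conj. 7.1 (pp. 22–26)] [cite: Grimmett2006, §3.9 eq. (3.94) (pp. 63–65); §1.5 Thm. (1.23) (p. 19)]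
-/

noncomputable section

namespace Summit.CriticalPhenomena.PercolationContinuityZ3.Theorems

namespace FK

/-- **Conjecture nodes: `EdgeNegCorrAdjFKLtOne → ArborealHubPos`** — adjacent-edge negative correlation of the random-cluster measure
for `q < 1` implies Ayyer–Linusson–Ravichandran's Conjecture 7.1 (hub inequality for the arboreal gas, arbitrary activities).
[cite: AyyerLinussonRavichandran2025, §7 Conj. 7.1 (p. 22)] [cite: Grimmett2006, §3.9 eq. (3.94) (p. 63); §1.5 Thm. (1.23) (p. 19)] -/
theorem arborealHubPos_of_edgeNegCorrAdjFKLtOne (h : EdgeNegCorrAdjFKLtOne) : ArborealHubPos :=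
  arborealHubPos_of_hubFKPos (hubFKPos_of_edgeNegCorrAdjFKLtOne h)

/-- **Conjecture nodes: `HubCovBoundFKLtOne → ArborealHubPos`** — fk-3's hub covariance bound (`q < 1`) implies ALR's Conjecture 7.1.
[cite: AyyerLinussonRavichandran2025, §7 Conj. 7.1 (p. 22)] [cite: Grimmett2006, §3.9 (pp. 63–65)] -/
theorem arborealHubPos_of_hubCovBoundFKLtOne (h : HubCovBoundFKLtOne) : ArborealHubPos :=
  arborealHubPos_of_hubFKPos (hubFKPos_of_hubCovBoundFKLtOne h)

end FK

end Summit.CriticalPhenomena.PercolationContinuityZ3.Theorems
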